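import Literature.MathematicalPhysics.QuantumFieldTheory.Balaban1983to89.T4HaarSU2ExpChart
import HarnessLib

/-!
# The own-axis class-angle shift on `SU(2)` — definitions

Defs module (D-0009) for the strip ∕ core translate arguments in the untwisted seam sector (memo HOME `bc/g14-dw/PLAN-PERIODIC.md` §B(γ), §C;
items stmt-QuantumFields-23948 ∕ 23949 ∕ 23957 of seat ym-idea-4's LINES g12-A/B).  In the quaternion model of `SU(2)` (tree `su2Quat`,
`expPoint x = exp(ι x)`):

* `imVec q ∈ ℝ³` — the imaginary part of a quaternion as a Euclidean vector (left inverse of the tree's `imQuat : ℝ³ → Im ℍ`);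
* `axisVec W = imVec(q)/‖imVec(q)‖`, `q = su2Quat W` — the unit AXIS of `W = cos r + sin r · ι(axis)` (`0` at the centre `W = ±1`);
* `classShift θ W = exp(ι(θ · axisVec W)) · W` — the OWN-AXIS SHIFT: it moves the class angle `r ↦ r + θ` along the ray of `W` and fixes the axis
  (`classShift θ (exp(ι(r ω))) = exp(ι((r+θ) ω))` for `0 < r < π`, `‖ω‖ = 1`; companion module `QuantileBitPuritySU2ClassShiftRay`), the map `ψ` of the
  one-link Jacobian lemma `ClassShift.lintegral_indicator_comp_shift_le` (`Theorems/QuantileBitPuritySU2ClassShiftJacobian.lean`).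

DEFINITIONS ONLY.  HONEST FRAMING: elementary objects on one compact group; nothing about lattice gauge theory, infinite volume, the continuum
limit or the Clay gap.  References: [folklore].
-/

set_option autoImplicit false

noncomputable section

open scoped Quaternion

namespace Summit.QuantumFields.YangMills.Theorems.FemtoTransferGap.ClassShift

open Literature.MathematicalPhysics.QuantumLattice (su2Quat)
open Literature.MathematicalPhysics.QuantumFieldTheory.Balaban1983to89.T4HaarSU2ExpChart (expPoint)

/-- **The imaginary part of a quaternion as a vector of `ℝ³`** (`= EuclideanSpace ℝ (Fin 3)`): `imVec ⟨a, b, c, d⟩ = (b, c, d)`; a left inverse of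
the tree's `imQuat`. [folklore] -/
def imVec (q : ℍ) : EuclideanSpace ℝ (Fin 3) := WithLp.toLp 2 ![q.imI, q.imJ, q.imK]

/-- **The unit axis of an element of `SU(2)`**: `axisVec W = Im(q)/‖Im(q)‖` for `q = su2Quat W` (so `W = cos r + sin r · ι(axisVec W)` with
`r ∈ (0, π)` the class angle); the junk value `0` at the centre `W = ±1`. [folklore] -/
def axisVec (W : Matrix.specialUnitaryGroup (Fin 2) ℂ) : EuclideanSpace ℝ (Fin 3) :=
  ‖imVec (su2Quat W)‖⁻¹ • imVec (su2Quat W)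

/-- **The own-axis class-angle shift** `classShift θ W = exp(ι(θ · axisVec W)) · W`: rotate `W` further by the angle `θ` about its own axis
(class angle `r ↦ r + θ`, axis fixed; the identity at the centre). [folklore] -/
def classShift (θ : ℝ) (W : Matrix.specialUnitaryGroup (Fin 2) ℂ) : Matrix.specialUnitaryGroup (Fin 2) ℂ :=
  expPoint (θ • axisVec W) * W

/-- `imVec` unfolded componentwise. [folklore] -/
theorem imVec_apply (q : ℍ) (i : Fin 3) : imVec q i = ![q.imI, q.imJ, q.imK] i := rfl

/-- `classShift` unfolded. [folklore] -/
theorem classShift_apply (θ : ℝ) (W : Matrix.specialUnitaryGroup (Fin 2) ℂ) : classShift θ W = expPoint (θ • axisVec W) * W := rfl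

end Summit.QuantumFields.YangMills.Theorems.FemtoTransferGap.ClassShift

end
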